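import Summits.ABC.IUTFork.Repair.RHOffRemainderToleranceSUnit
import HarnessLib

/-!
# R-H PAIR-5 TESTER, part 3/3 (§5): THE KERNEL REFUTATION of the [TOL] binder of row 5's abc-end `abc_of_offRemainder_sigmaFive_le_tol` —
# at every fixed prime `l ≥ 11` (`not_offRemainder_sigmaFive_le_tol_at_prime`) and VERBATIM (`not_offRemainder_sigmaFive_le_tol`)

PROXY-FILED by abc-iut-rh-typ-5 (gen 5) for abc-iut-rh-tst-5 (gen 4) (refuter seats cannot stage under `Repair/`), 2026-08-27. The gate's proof-file
lint (≤ 400 lines) forces the tester's single staged file `RHOffRemainderToleranceRefutation.lean` (sha16 6609a97ef1f7db89, 757 l) to be SPLIT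
VERBATIM into three files of one namespace `Summit.ABC.IUTFork.Repair.RH.OffRemainderTolerance`, no declaration changed:
`RHOffRemainderToleranceMechanism.lean` (§1–§3), `RHOffRemainderToleranceSUnit.lean` (§4), `RHOffRemainderToleranceRefutation.lean` (§5, the
refutation theorems of record). The text below is the tester's, unchanged.
See `RHOffRemainderToleranceMechanism.lean` (part 1/3) for the full statement of results, mechanism, classification (`refuted-misstated`; repaired
statements of record C′₁ = [TOL-bad] p478095, C′₂ = [ρ, WINDOW], both MISSED by the witness; content-guarded [TOL-C]/[MU-C] ends NOT in scope) and
honest framing (abc-iut-rh-tst-5 gen 4, verbatim). HONEST FRAMING: «this binder is false AS TYPED», nothing more; nothing here asserts that abc is proved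
or refuted, or that [IUTchIII] Cor. 3.12 holds or fails at any datum; no side taken on any author; typed ≠ proved; instantiated ≠ endorsed.
[cite: Mochizuki2012, IUTchIV Thm. 1.10 pp. 22–31, Step (v) pp. 27–28; Cor. 2.2 (ii)–(iii) pp. 41–48] [cite: Mochizuki2012, IUTchIII Cor. 3.12 p. 174]
[cite: DupuyHilado2025, §3.3, §3.6, §4.7, §4.12] [claim: Mochizuki2012, status: disputed] for every IUT quotation.
-/

noncomputable section

open Set Function NumberField IsDedekindDomain
open scoped Pointwise

namespace Summit.ABC.IUTFork.Repair.RH.OffRemainderTolerance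

open Summit.ABC.IUTFork.Thm311 Summit.ABC.IUTFork.Thm311.Real Summit.ABC.IUTFork.Cor312 Summit.ABC.IUTFork.Cor312.Setting
  Summit.ABC.IUTFork.Cor312Vol Summit.ABC.IUTFork.Cor312Prov Summit.ABC.IUTFork.Repair.RH.SigmaLicence
  Literature.IUT.LogThetaLattice Literature.IUT.LogVolume Literature.IUT.HodgeTheaters Literature.NumberTheory.NumberFields

/-! ## §5. THE KERNEL REFUTATION of the [TOL] binder: at every fixed prime `l ≥ 11`, and VERBATIM -/

section Refutation

open Summit.ABC.IUTFork.SUnitFamily Literature.NumberTheory.DiophantineGeometry.GenEll Summit.ABC.ABC.Theorems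
  Summit.ABC.IUTFork.PointDict Summit.ABC.IUTFork.Conditional Literature.IUT.LogVolume.ThetaData
  Summit.ABC.IUTFork.Repair.RH.SigmaStrataEq Summit.ABC.IUTFork.Repair.RH

/-- **THE `l`-SLICE OF [TOL] IS FALSE AT EVERY FIXED PRIME `l ≥ 11`** (for every choice of the context functions `M, archPk, …, qData`).
At the S-unit points `P_{a,c}` (`a, c ≡ 1 (mod l)`, `7^c ≤ 5^a ≤ 5^l·7^c`, `c` large; admissible at `l`: abc-iut-s2-p4 parts II–IV +
`Cor22.condP6_of_seven_le` on `K_∞(5^l)`), a genuine Θ-volume datum `T` exists (`ThetaPartII.stub_thetaData`, PROVED in the tree), the strata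
invariance `R_{Σ₅}(T) = R_∅(T)` (rh2-q2-eq `SigmaStrataEq.offRemainder_sigmaFive_eq_offRemainder_empty`) and §4's datum lower bound give
`c·((l(l+1)/12 − 1)·log 7 / l) − C(l) ≤ R_{Σ₅}(T)`, while the tolerance `((l+1)/4)·5·(2¹²·3³·5·2)·l` does not depend on `c` — absurd.
A statement about OUR typed objects; no side taken on [IUTchIII] Cor. 3.12 or [IUTchIV] Thm. 1.10.
[cite: Mochizuki2012, IUTchIV Thm. 1.10 Step (v)–(viii) pp. 27–29] [cite: Mochizuki2012, IUTchIV Cor. 2.2 (ii) proof (P1)–(P7) pp. 45–46]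
[claim: Mochizuki2012, status: disputed] -/
theorem not_offRemainder_sigmaFive_le_tol_at_prime {l : ℕ} (hl : l.Prime) (h11 : 11 ≤ l)
    (M : ∀ (P : NFPoint) (l : ℕ) (T : Cor22.ThetaVolumeDatumAt P l), Type) [∀ P l T, Field (M P l T)] [∀ P l T, NumberField (M P l T)]
    (archPk : ∀ (P : NFPoint) (l : ℕ) (T : Cor22.ThetaVolumeDatumAt P l), letI := T.instFieldF; letI := T.instNumberFieldF; letI := T.instAlgebraF; letI := T.instFieldK;
        letI := T.instNumberFieldK; letI := T.instAlgebraK; letI := T.instFieldFbar; letI := T.instAlgebraFbar;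
        letI := T.instAlgebraKFbar; letI := T.instIsElliptic;
      ∀ (j : (thetaIndex (pilotDataOfK T.D T.K)).Label) (vQ : (thetaIndex (pilotDataOfK T.D T.K)).VQ), Set ((logShellsDH (pilotDataOfK T.D T.K) (analyticLogv T.K)).Packet j vQ))
    (archSub : ∀ (P : NFPoint) (l : ℕ) (T : Cor22.ThetaVolumeDatumAt P l), letI := T.instFieldF; letI := T.instNumberFieldF; letI := T.instAlgebraF; letI := T.instFieldK;
        letI := T.instNumberFieldK; letI := T.instAlgebraK; letI := T.instFieldFbar; letI := T.instAlgebraFbar;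
        letI := T.instAlgebraKFbar; letI := T.instIsElliptic;
      ∀ (j : (thetaIndex (pilotDataOfK T.D T.K)).Label) (v : (thetaIndex (pilotDataOfK T.D T.K)).V), Set ((logShellsDH (pilotDataOfK T.D T.K) (analyticLogv T.K)).Packet j ((thetaIndex (pilotDataOfK T.D T.K)).over v)))
    (Ψ : ∀ (P : NFPoint) (l : ℕ) (T : Cor22.ThetaVolumeDatumAt P l), letI := T.instFieldF; letI := T.instNumberFieldF; letI := T.instAlgebraF; letI := T.instFieldK;
        letI := T.instNumberFieldK; letI := T.instAlgebraK; letI := T.instFieldFbar; letI := T.instAlgebraFbar;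
        letI := T.instAlgebraKFbar; letI := T.instIsElliptic;
      ℤ → ∀ v : (thetaIndex (pilotDataOfK T.D T.K)).V, v ∈ (thetaIndex (pilotDataOfK T.D T.K)).Vbad → Set ((logShellsDH (pilotDataOfK T.D T.K) (analyticLogv T.K)).StarPacket v))
    (act : ∀ (P : NFPoint) (l : ℕ) (T : Cor22.ThetaVolumeDatumAt P l), letI := T.instFieldF; letI := T.instNumberFieldF; letI := T.instAlgebraF; letI := T.instFieldK;
        letI := T.instNumberFieldK; letI := T.instAlgebraK; letI := T.instFieldFbar; letI := T.instAlgebraFbar;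
        letI := T.instAlgebraKFbar; letI := T.instIsElliptic;
      ℤ → ∀ v : (thetaIndex (pilotDataOfK T.D T.K)).V, v ∈ (thetaIndex (pilotDataOfK T.D T.K)).Vbad → (logShellsDH (pilotDataOfK T.D T.K) (analyticLogv T.K)).StarPacket v → Module.End ℚ ((logShellsDH (pilotDataOfK T.D T.K) (analyticLogv T.K)).StarPacket v))
    (Mmod : ∀ (P : NFPoint) (l : ℕ) (T : Cor22.ThetaVolumeDatumAt P l), letI := T.instFieldF; letI := T.instNumberFieldF; letI := T.instAlgebraF; letI := T.instFieldK;
        letI := T.instNumberFieldK; letI := T.instAlgebraK; letI := T.instFieldFbar; letI := T.instAlgebraFbar;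
        letI := T.instAlgebraKFbar; letI := T.instIsElliptic;
      ℤ → ∀ j : (thetaIndex (pilotDataOfK T.D T.K)).LabelStar, Set ((logShellsDH (pilotDataOfK T.D T.K) (analyticLogv T.K)).GlobalPacket j.1))
    (region : ∀ (P : NFPoint) (l : ℕ) (T : Cor22.ThetaVolumeDatumAt P l), letI := T.instFieldF; letI := T.instNumberFieldF; letI := T.instAlgebraF; letI := T.instFieldK;
        letI := T.instNumberFieldK; letI := T.instAlgebraK; letI := T.instFieldFbar; letI := T.instAlgebraFbar;
        letI := T.instAlgebraKFbar; letI := T.instIsElliptic;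
      ℤ → ∀ j : (thetaIndex (pilotDataOfK T.D T.K)).LabelStar, FinDivisor (M P l T) → ∀ vQ : (thetaIndex (pilotDataOfK T.D T.K)).VQ, Set ((logShellsDH (pilotDataOfK T.D T.K) (analyticLogv T.K)).Packet j.1 vQ))
    (n : ∀ (P : NFPoint) (l : ℕ) (T : Cor22.ThetaVolumeDatumAt P l), ℤ)
    {HT : ∀ (P : NFPoint) (l : ℕ) (T : Cor22.ThetaVolumeDatumAt P l), Type} {LogLink : ∀ (P : NFPoint) (l : ℕ) (T : Cor22.ThetaVolumeDatumAt P l), HT P l T → HT P l T → Type}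
    {IsFull : ∀ (P : NFPoint) (l : ℕ) (T : Cor22.ThetaVolumeDatumAt P l), ∀ {s t : HT P l T}, LogLink P l T s t → Prop}
    (lat : ∀ (P : NFPoint) (l : ℕ) (T : Cor22.ThetaVolumeDatumAt P l), LGPGaussianLogThetaLattice (LogLink P l T) (IsFull P l T))
    {Frd : ∀ (P : NFPoint) (l : ℕ) (T : Cor22.ThetaVolumeDatumAt P l), Type} {IsoF : ∀ (P : NFPoint) (l : ℕ) (T : Cor22.ThetaVolumeDatumAt P l), Frd P l T → Frd P l T → Type} {Ob : ∀ (P : NFPoint) (l : ℕ) (T : Cor22.ThetaVolumeDatumAt P l), Frd P l T → Type}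
    {realify : ∀ (P : NFPoint) (l : ℕ) (T : Cor22.ThetaVolumeDatumAt P l), Frd P l T → Frd P l T} {Strip : ∀ (P : NFPoint) (l : ℕ) (T : Cor22.ThetaVolumeDatumAt P l), Type} {IsoS : ∀ (P : NFPoint) (l : ℕ) (T : Cor22.ThetaVolumeDatumAt P l), Strip P l T → Strip P l T → Type}
    {Mv : ∀ (P : NFPoint) (l : ℕ) (T : Cor22.ThetaVolumeDatumAt P l), letI := T.instFieldF; letI := T.instNumberFieldF; letI := T.instAlgebraF; letI := T.instFieldK;
        letI := T.instNumberFieldK; letI := T.instAlgebraK; letI := T.instFieldFbar; letI := T.instAlgebraFbar;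
        letI := T.instAlgebraKFbar; letI := T.instIsElliptic;
      ∀ v : (thetaIndex (pilotDataOfK T.D T.K)).V, v ∈ (thetaIndex (pilotDataOfK T.D T.K)).Vbad → Type}
    [∀ P l T v h, Monoid (Mv P l T v h)]
    (sig : ∀ (P : NFPoint) (l : ℕ) (T : Cor22.ThetaVolumeDatumAt P l), letI := T.instFieldF; letI := T.instNumberFieldF; letI := T.instAlgebraF; letI := T.instFieldK;
        letI := T.instNumberFieldK; letI := T.instAlgebraK; letI := T.instFieldFbar; letI := T.instAlgebraFbar;
        letI := T.instAlgebraKFbar; letI := T.instIsElliptic;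
      GlobalLGPFrobenioidSignature (thetaIndex (pilotDataOfK T.D T.K)).lstar (thetaIndex (pilotDataOfK T.D T.K)).V (· ∈ (thetaIndex (pilotDataOfK T.D T.K)).Vbad) (Frd P l T) (IsoF P l T) (Ob P l T) (realify P l T)
        (Strip P l T) (IsoS P l T) (Mv P l T))
    (split : ∀ (P : NFPoint) (l : ℕ) (T : Cor22.ThetaVolumeDatumAt P l), SplittingMonoids (Mv P l T))
    {ObΔ : ∀ (P : NFPoint) (l : ℕ) (T : Cor22.ThetaVolumeDatumAt P l), Type} {N : ∀ (P : NFPoint) (l : ℕ) (T : Cor22.ThetaVolumeDatumAt P l), letI := T.instFieldF; letI := T.instNumberFieldF; letI := T.instAlgebraF; letI := T.instFieldK;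
        letI := T.instNumberFieldK; letI := T.instAlgebraK; letI := T.instFieldFbar; letI := T.instAlgebraFbar;
        letI := T.instAlgebraKFbar; letI := T.instIsElliptic;
      ∀ v : (thetaIndex (pilotDataOfK T.D T.K)).V, v ∈ (thetaIndex (pilotDataOfK T.D T.K)).Vbad → Type}
    [∀ P l T v h, Monoid (N P l T v h)] (qData : ∀ (P : NFPoint) (l : ℕ) (T : Cor22.ThetaVolumeDatumAt P l), QPilotData (ObΔ P l T) (N P l T)) :
    ¬ (∀ P : NFPoint, P ∈ UP → Cor22.AdmitsCore P → Cor22.CondP2 P l → Cor22.CondP5 P l → Cor22.CondP6 P l →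
      ∀ T : Cor22.ThetaVolumeDatumAt P l, letI := T.instFieldF; letI := T.instNumberFieldF; letI := T.instAlgebraF; letI := T.instFieldK;
        letI := T.instNumberFieldK; letI := T.instAlgebraK; letI := T.instFieldFbar; letI := T.instAlgebraFbar;
        letI := T.instAlgebraKFbar; letI := T.instIsElliptic;
      offRemainder
        (settingPrVolSharp (pilotDataOfK T.D T.K) (logvAnalytic_analyticLogv (F := T.K)) (M P l T) (archPk P l T) (archSub P l T) (Ψ P l T)
          (act P l T) (Mmod P l T) (region P l T) (n P l T) (lat P l T) (sig P l T) (split P l T) (qData P l T)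
          (exists_realising_qIdeles_pilotDataOfK T.D).choose
          (exists_realising_thetaIdeles_pilotDataOfK T.D).choose
          (exists_realising_qIdeles_pilotDataOfK T.D).choose_spec.1
          (exists_realising_qIdeles_pilotDataOfK T.D).choose_spec.2.1)
        (TameBandLicenceSigma.sigmaFive T.D) ≤
        ((l : ℝ) + 1) / 4 * (5 * ((((2 ^ 12 * 3 ^ 3 * 5 * Cor22.dmod P : ℕ) : ℝ)) * l))) := by
  intro hvol
  have hl2 : 2 ≤ l := hl.two_le
  have hl5 : 5 ≤ l := by omega
  have hl5' : l ≠ 5 := by omega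
  have hlne2 : l ≠ 2 := by omega
  have hl7 : 7 ≤ l := by omega
  have hlr : (11 : ℝ) ≤ (l : ℝ) := by exact_mod_cast h11
  have hl0 : (0 : ℝ) < (l : ℝ) := by linarith
  have hlog5 : 0 < Real.log 5 := Real.log_pos (by norm_num)
  have hlog7 : 0 < Real.log 7 := Real.log_pos (by norm_num)
  obtain ⟨R, hRdef⟩ : ∃ R : ℝ, R = (5 : ℝ) ^ l := ⟨_, rfl⟩
  have hR : 1 ≤ R := hRdef ▸ one_le_pow₀ (by norm_num)
  obtain ⟨HK, hHK⟩ := Cor22.condP6_of_seven_le (cbTwoDiscs R hR)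
  -- the slope of the datum lower bound in `c`, the `l`-only constant, and the tolerance at `d_mod = 2`
  obtain ⟨s, hsdef⟩ : ∃ s : ℝ, s = ((l : ℝ) * ((l : ℝ) + 1) / 12 - 1) * (Real.log 7 / l) := ⟨_, rfl⟩
  have hs : 0 < s := by
    have h1 : (0 : ℝ) < (l : ℝ) * ((l : ℝ) + 1) / 12 - 1 := by nlinarith
    rw [hsdef]
    exact mul_pos h1 (div_pos hlog7 hl0)
  obtain ⟨Cl, hCl⟩ : ∃ Cl : ℝ, Cl = 2 * (((l : ℝ) + 5) / 4 * (Real.log 7 + 2 * Real.log (368640 * (l : ℝ) ^ 4) + 3)) + Real.log 7 :=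
    ⟨_, rfl⟩
  obtain ⟨Tol, hTol⟩ : ∃ Tol : ℝ, Tol = ((l : ℝ) + 1) / 4 * (5 * ((((2 ^ 12 * 3 ^ 3 * 5 * 2 : ℕ) : ℝ)) * l)) := ⟨_, rfl⟩
  -- choose the exponents
  obtain ⟨m, hm⟩ := exists_nat_gt (max (HK / Real.log 5) ((Cl + Tol) / s))
  obtain ⟨a, c, ha, hc, hla, hlc, hlo, hhi⟩ := exists_exponents l hl2 m
  have ha1 : 1 ≤ a := by omega
  have hc1 : 1 ≤ c := by omega
  have hbigA : HK < (a : ℝ) * Real.log 5 := by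
    have h1 : HK / Real.log 5 < m := lt_of_le_of_lt (le_max_left _ _) hm
    rw [div_lt_iff₀ hlog5] at h1
    have h2 : (m : ℝ) * Real.log 5 ≤ (a : ℝ) * Real.log 5 :=
      mul_le_mul_of_nonneg_right (by exact_mod_cast (by omega : m ≤ a)) hlog5.le
    linarith
  have hbigC : Cl + Tol < (c : ℝ) * s := by
    have h1 : (Cl + Tol) / s < m := lt_of_le_of_lt (le_max_right _ _) hm
    rw [div_lt_iff₀ hs] at h1
    have h2 : (m : ℝ) * s ≤ (c : ℝ) * s := mul_le_mul_of_nonneg_right (by exact_mod_cast (by omega : m ≤ c)) hs.le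
    linarith
  -- admissibility of `P_{a,c}` at `l`
  have hP : Pt a c ∈ UP := P_mem_UP ha1 hc1
  have hcore : Cor22.AdmitsCore (Pt a c) := admitsCore_P ha1 hc1
  have h2 : Cor22.CondP2 (Pt a c) l := condP2_P ha1 hc1 hl hlne2 hla hlc
  have h5 : Cor22.CondP5 (Pt a c) l := condP5_P ha1 hc1 hl hl5'
  have hd : Cor22.dmod (Pt a c) = 2 := dmod_P ha1 hc1
  have hmem : Pt a c ∈ (cbTwoDiscs R hR).toSet :=
    P_mem_cbTwoDiscs (a := a) (c := c) hR (by exact_mod_cast hlo) (by rw [hRdef]; exact_mod_cast hhi)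
  have hq : (a : ℝ) * Real.log 5 ≤ Cor22.logQForall (Pt a c) := le_logQForall_P ha1 hc1
  have h6 : Cor22.CondP6 (Pt a c) l := hHK (Pt a c) hmem hP l hl hl7 h2 h5 (by linarith)
  -- a genuine datum, the [TOL] bound there, the strata invariance, and the datum lower bound
  obtain ⟨T⟩ := ThetaPartII.stub_thetaData (Pt a c) hP l hl hl5 hcore h2 h5 h6
  have hle := hvol (Pt a c) hP hcore h2 h5 h6 T
  letI := T.instFieldF; letI := T.instNumberFieldF; letI := T.instAlgebraF; letI := T.instFieldK
  letI := T.instNumberFieldK; letI := T.instAlgebraK; letI := T.instFieldFbar; letI := T.instAlgebraFbar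
  letI := T.instAlgebraKFbar; letI := T.instIsElliptic
  have heq := offRemainder_sigmaFive_eq_offRemainder_empty T.D (logvAnalytic_analyticLogv (F := T.K)) (M (Pt a c) l T)
    (archPk (Pt a c) l T) (archSub (Pt a c) l T) (Ψ (Pt a c) l T) (act (Pt a c) l T) (Mmod (Pt a c) l T) (region (Pt a c) l T)
    (n (Pt a c) l T) (lat (Pt a c) l T) (sig (Pt a c) l T) (split (Pt a c) l T) (qData (Pt a c) l T)
    (exists_realising_qIdeles_pilotDataOfK T.D).choose (exists_realising_thetaIdeles_pilotDataOfK T.D).choose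
    (exists_realising_qIdeles_pilotDataOfK T.D).choose_spec.1 (exists_realising_qIdeles_pilotDataOfK T.D).choose_spec.2.1
    (exists_realising_thetaIdeles_pilotDataOfK T.D).choose_spec.1 (exists_realising_thetaIdeles_pilotDataOfK T.D).choose_spec.2.2
    (exists_realising_qIdeles_pilotDataOfK T.D).choose_spec.2.2
  have hge := datum_offRemainder_empty_ge ha1 hc1 hl h11 T (M (Pt a c) l T)
    (archPk (Pt a c) l T) (archSub (Pt a c) l T) (Ψ (Pt a c) l T) (act (Pt a c) l T) (Mmod (Pt a c) l T) (region (Pt a c) l T)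
    (n (Pt a c) l T) (lat (Pt a c) l T) (sig (Pt a c) l T) (split (Pt a c) l T) (qData (Pt a c) l T)
    (exists_realising_qIdeles_pilotDataOfK T.D).choose (exists_realising_thetaIdeles_pilotDataOfK T.D).choose
    (exists_realising_qIdeles_pilotDataOfK T.D).choose_spec.1 (exists_realising_qIdeles_pilotDataOfK T.D).choose_spec.2.1
    (exists_realising_thetaIdeles_pilotDataOfK T.D).choose_spec.1 (exists_realising_thetaIdeles_pilotDataOfK T.D).choose_spec.2.2
    (exists_realising_qIdeles_pilotDataOfK T.D).choose_spec.2.2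
  rw [heq, hd] at hle
  have hring : ((l : ℝ) * ((l : ℝ) + 1) / 12 - 1) * ((c : ℝ) / l * Real.log 7) = (c : ℝ) * s := by
    rw [hsdef]; ring
  linarith

/-- **THE [TOL] BINDER OF `abc_of_offRemainder_sigmaFive_le_tol` IS FALSE, VERBATIM** (p472385, abc-iut-rh2-q4-typ; the SAME binder is explicit 2
of the recut `abc_of_offRemainder_sigmaFive_le_tol_hregBad`): for every choice of the context functions `M, …, qData`, the uniform tolerance
«`R_{Σ₅}(T) ≤ ((l+1)/4)·5·(2¹²·3³·5·d_mod)·l` at the chosen realising ideles of EVERY genuine Θ-volume datum `T` of EVERY admissible `(P, l)`» fails —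
already its `l = 11` slice does (`not_offRemainder_sigmaFive_le_tol_at_prime`). CLASS `refuted-misstated`: the witness (S-unit points at a FIXED
`l`, `c → ∞`) exploits the absence of print's COUPLING of `l` to the height (`l ~ √(ht)`, [IUTchIV] Cor. 2.2 (ii) (P3)) / of the Szpiro-bad guard;
the REPAIRED statement of record is the guarded binder [TOL-bad] of `abc_of_offRemainder_sigmaFive_le_tol_szpiroBad_hregBad` (p478095), which this
witness MISSES (a generic member `P_{a,c}` is Szpiro-GOOD: abc-iut-s2-p4 `szpiroBad_iff_log_discr_lt` — the guard is a powerful-value event for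
`5^{2a} + 4·7^{2c}`). No side taken on [IUTchIII] Cor. 3.12 / [IUTchIV] Thm. 1.10; «these typed hypotheses are jointly unsatisfiable», nothing more.
[cite: Mochizuki2012, IUTchIV Thm. 1.10 pp. 22–31; Cor. 2.2 (ii)–(iii) pp. 45–47] [claim: Mochizuki2012, status: disputed] -/
theorem not_offRemainder_sigmaFive_le_tol
    (M : ∀ (P : NFPoint) (l : ℕ) (T : Cor22.ThetaVolumeDatumAt P l), Type) [∀ P l T, Field (M P l T)] [∀ P l T, NumberField (M P l T)]
    (archPk : ∀ (P : NFPoint) (l : ℕ) (T : Cor22.ThetaVolumeDatumAt P l), letI := T.instFieldF; letI := T.instNumberFieldF; letI := T.instAlgebraF; letI := T.instFieldK;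
        letI := T.instNumberFieldK; letI := T.instAlgebraK; letI := T.instFieldFbar; letI := T.instAlgebraFbar;
        letI := T.instAlgebraKFbar; letI := T.instIsElliptic;
      ∀ (j : (thetaIndex (pilotDataOfK T.D T.K)).Label) (vQ : (thetaIndex (pilotDataOfK T.D T.K)).VQ), Set ((logShellsDH (pilotDataOfK T.D T.K) (analyticLogv T.K)).Packet j vQ))
    (archSub : ∀ (P : NFPoint) (l : ℕ) (T : Cor22.ThetaVolumeDatumAt P l), letI := T.instFieldF; letI := T.instNumberFieldF; letI := T.instAlgebraF; letI := T.instFieldK;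
        letI := T.instNumberFieldK; letI := T.instAlgebraK; letI := T.instFieldFbar; letI := T.instAlgebraFbar;
        letI := T.instAlgebraKFbar; letI := T.instIsElliptic;
      ∀ (j : (thetaIndex (pilotDataOfK T.D T.K)).Label) (v : (thetaIndex (pilotDataOfK T.D T.K)).V), Set ((logShellsDH (pilotDataOfK T.D T.K) (analyticLogv T.K)).Packet j ((thetaIndex (pilotDataOfK T.D T.K)).over v)))
    (Ψ : ∀ (P : NFPoint) (l : ℕ) (T : Cor22.ThetaVolumeDatumAt P l), letI := T.instFieldF; letI := T.instNumberFieldF; letI := T.instAlgebraF; letI := T.instFieldK;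
        letI := T.instNumberFieldK; letI := T.instAlgebraK; letI := T.instFieldFbar; letI := T.instAlgebraFbar;
        letI := T.instAlgebraKFbar; letI := T.instIsElliptic;
      ℤ → ∀ v : (thetaIndex (pilotDataOfK T.D T.K)).V, v ∈ (thetaIndex (pilotDataOfK T.D T.K)).Vbad → Set ((logShellsDH (pilotDataOfK T.D T.K) (analyticLogv T.K)).StarPacket v))
    (act : ∀ (P : NFPoint) (l : ℕ) (T : Cor22.ThetaVolumeDatumAt P l), letI := T.instFieldF; letI := T.instNumberFieldF; letI := T.instAlgebraF; letI := T.instFieldK;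
        letI := T.instNumberFieldK; letI := T.instAlgebraK; letI := T.instFieldFbar; letI := T.instAlgebraFbar;
        letI := T.instAlgebraKFbar; letI := T.instIsElliptic;
      ℤ → ∀ v : (thetaIndex (pilotDataOfK T.D T.K)).V, v ∈ (thetaIndex (pilotDataOfK T.D T.K)).Vbad → (logShellsDH (pilotDataOfK T.D T.K) (analyticLogv T.K)).StarPacket v → Module.End ℚ ((logShellsDH (pilotDataOfK T.D T.K) (analyticLogv T.K)).StarPacket v))
    (Mmod : ∀ (P : NFPoint) (l : ℕ) (T : Cor22.ThetaVolumeDatumAt P l), letI := T.instFieldF; letI := T.instNumberFieldF; letI := T.instAlgebraF; letI := T.instFieldK;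
        letI := T.instNumberFieldK; letI := T.instAlgebraK; letI := T.instFieldFbar; letI := T.instAlgebraFbar;
        letI := T.instAlgebraKFbar; letI := T.instIsElliptic;
      ℤ → ∀ j : (thetaIndex (pilotDataOfK T.D T.K)).LabelStar, Set ((logShellsDH (pilotDataOfK T.D T.K) (analyticLogv T.K)).GlobalPacket j.1))
    (region : ∀ (P : NFPoint) (l : ℕ) (T : Cor22.ThetaVolumeDatumAt P l), letI := T.instFieldF; letI := T.instNumberFieldF; letI := T.instAlgebraF; letI := T.instFieldK;
        letI := T.instNumberFieldK; letI := T.instAlgebraK; letI := T.instFieldFbar; letI := T.instAlgebraFbar;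
        letI := T.instAlgebraKFbar; letI := T.instIsElliptic;
      ℤ → ∀ j : (thetaIndex (pilotDataOfK T.D T.K)).LabelStar, FinDivisor (M P l T) → ∀ vQ : (thetaIndex (pilotDataOfK T.D T.K)).VQ, Set ((logShellsDH (pilotDataOfK T.D T.K) (analyticLogv T.K)).Packet j.1 vQ))
    (n : ∀ (P : NFPoint) (l : ℕ) (T : Cor22.ThetaVolumeDatumAt P l), ℤ)
    {HT : ∀ (P : NFPoint) (l : ℕ) (T : Cor22.ThetaVolumeDatumAt P l), Type} {LogLink : ∀ (P : NFPoint) (l : ℕ) (T : Cor22.ThetaVolumeDatumAt P l), HT P l T → HT P l T → Type}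
    {IsFull : ∀ (P : NFPoint) (l : ℕ) (T : Cor22.ThetaVolumeDatumAt P l), ∀ {s t : HT P l T}, LogLink P l T s t → Prop}
    (lat : ∀ (P : NFPoint) (l : ℕ) (T : Cor22.ThetaVolumeDatumAt P l), LGPGaussianLogThetaLattice (LogLink P l T) (IsFull P l T))
    {Frd : ∀ (P : NFPoint) (l : ℕ) (T : Cor22.ThetaVolumeDatumAt P l), Type} {IsoF : ∀ (P : NFPoint) (l : ℕ) (T : Cor22.ThetaVolumeDatumAt P l), Frd P l T → Frd P l T → Type} {Ob : ∀ (P : NFPoint) (l : ℕ) (T : Cor22.ThetaVolumeDatumAt P l), Frd P l T → Type}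
    {realify : ∀ (P : NFPoint) (l : ℕ) (T : Cor22.ThetaVolumeDatumAt P l), Frd P l T → Frd P l T} {Strip : ∀ (P : NFPoint) (l : ℕ) (T : Cor22.ThetaVolumeDatumAt P l), Type} {IsoS : ∀ (P : NFPoint) (l : ℕ) (T : Cor22.ThetaVolumeDatumAt P l), Strip P l T → Strip P l T → Type}
    {Mv : ∀ (P : NFPoint) (l : ℕ) (T : Cor22.ThetaVolumeDatumAt P l), letI := T.instFieldF; letI := T.instNumberFieldF; letI := T.instAlgebraF; letI := T.instFieldK;
        letI := T.instNumberFieldK; letI := T.instAlgebraK; letI := T.instFieldFbar; letI := T.instAlgebraFbar;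
        letI := T.instAlgebraKFbar; letI := T.instIsElliptic;
      ∀ v : (thetaIndex (pilotDataOfK T.D T.K)).V, v ∈ (thetaIndex (pilotDataOfK T.D T.K)).Vbad → Type}
    [∀ P l T v h, Monoid (Mv P l T v h)]
    (sig : ∀ (P : NFPoint) (l : ℕ) (T : Cor22.ThetaVolumeDatumAt P l), letI := T.instFieldF; letI := T.instNumberFieldF; letI := T.instAlgebraF; letI := T.instFieldK;
        letI := T.instNumberFieldK; letI := T.instAlgebraK; letI := T.instFieldFbar; letI := T.instAlgebraFbar;
        letI := T.instAlgebraKFbar; letI := T.instIsElliptic;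
      GlobalLGPFrobenioidSignature (thetaIndex (pilotDataOfK T.D T.K)).lstar (thetaIndex (pilotDataOfK T.D T.K)).V (· ∈ (thetaIndex (pilotDataOfK T.D T.K)).Vbad) (Frd P l T) (IsoF P l T) (Ob P l T) (realify P l T)
        (Strip P l T) (IsoS P l T) (Mv P l T))
    (split : ∀ (P : NFPoint) (l : ℕ) (T : Cor22.ThetaVolumeDatumAt P l), SplittingMonoids (Mv P l T))
    {ObΔ : ∀ (P : NFPoint) (l : ℕ) (T : Cor22.ThetaVolumeDatumAt P l), Type} {N : ∀ (P : NFPoint) (l : ℕ) (T : Cor22.ThetaVolumeDatumAt P l), letI := T.instFieldF; letI := T.instNumberFieldF; letI := T.instAlgebraF; letI := T.instFieldK;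
        letI := T.instNumberFieldK; letI := T.instAlgebraK; letI := T.instFieldFbar; letI := T.instAlgebraFbar;
        letI := T.instAlgebraKFbar; letI := T.instIsElliptic;
      ∀ v : (thetaIndex (pilotDataOfK T.D T.K)).V, v ∈ (thetaIndex (pilotDataOfK T.D T.K)).Vbad → Type}
    [∀ P l T v h, Monoid (N P l T v h)] (qData : ∀ (P : NFPoint) (l : ℕ) (T : Cor22.ThetaVolumeDatumAt P l), QPilotData (ObΔ P l T) (N P l T)) :
    ¬ (∀ P : NFPoint, P ∈ UP → ∀ l : ℕ, l.Prime → 5 ≤ l →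
      Cor22.AdmitsCore P → Cor22.CondP2 P l → Cor22.CondP5 P l → Cor22.CondP6 P l →
      ∀ T : Cor22.ThetaVolumeDatumAt P l, letI := T.instFieldF; letI := T.instNumberFieldF; letI := T.instAlgebraF; letI := T.instFieldK;
        letI := T.instNumberFieldK; letI := T.instAlgebraK; letI := T.instFieldFbar; letI := T.instAlgebraFbar;
        letI := T.instAlgebraKFbar; letI := T.instIsElliptic;
      offRemainder
        (settingPrVolSharp (pilotDataOfK T.D T.K) (logvAnalytic_analyticLogv (F := T.K)) (M P l T) (archPk P l T) (archSub P l T) (Ψ P l T)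
          (act P l T) (Mmod P l T) (region P l T) (n P l T) (lat P l T) (sig P l T) (split P l T) (qData P l T)
          (exists_realising_qIdeles_pilotDataOfK T.D).choose
          (exists_realising_thetaIdeles_pilotDataOfK T.D).choose
          (exists_realising_qIdeles_pilotDataOfK T.D).choose_spec.1
          (exists_realising_qIdeles_pilotDataOfK T.D).choose_spec.2.1)
        (TameBandLicenceSigma.sigmaFive T.D) ≤
        ((l : ℝ) + 1) / 4 * (5 * ((((2 ^ 12 * 3 ^ 3 * 5 * Cor22.dmod P : ℕ) : ℝ)) * l))) :=
  fun h => not_offRemainder_sigmaFive_le_tol_at_prime (l := 11) (by norm_num) le_rfl M archPk archSub Ψ act Mmod region n lat sig split qData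
    fun P hP hcore h2 h5 h6 T => h P hP 11 (by norm_num) (by norm_num) hcore h2 h5 h6 T

end Refutation

end Summit.ABC.IUTFork.Repair.RH.OffRemainderTolerance

end
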